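import Literature.NumberTheory.EllipticCurves.KrizLi2019.EisensteinHeegnerLog
import HarnessLib

/-!
# ROUTE U — the Bernoulli characters of Kriz–Li Thm. 1.20 commute with `changeLevel` in `ε_K`

bsd-cm cell, ROUTE U (Theorem U: BSD(49a1^{(D)}, 7) ⇒ full BSD on `𝒞₇`). Thm. 1.20 (tree
`thm120_padicLogHeegner_unit_of_bernoulli`) takes the Kronecker character `ε_K` at the level
`|d_K| = (NumberField.discr K).natAbs` — a TERM, equal but not syntactically identical to the numeral
(`19` for `K'' = ℚ(√−19)`) at which the Bernoulli certificates (`RouteUBernoulliD11`,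
`RouteUHBD11`) are computed. The bridge is level change along `|d_K| ∣ 19` (from `|d_K| = 19`):
this file proves, generically, that the paper's characters `ψ₀` (`evenTwist`), `ψ₀⁻¹ε_K`
(`bernoulliCharOne`) and `ψ₀ω⁻¹` (`bernoulliCharTwo`) of a LIFTED `ε_K` are the lifts of those of
`ε_K` (`evenTwist_changeLevel`, `bernoulliCharOne_changeLevel`, `bernoulliCharTwo_changeLevel`), and
that the defining clause of `IsKroneckerCharacterOf` passes to the lift at prime arguments
(`changeLevel_apply_prime_of_not_dvd`). With `RouteUBernoulliCertificate.bernoulliOnePrim_changeLevel_eq`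
(`B_{1,χ̃}` depends only on the primitive character) the Bernoulli hypothesis `hB` is then
level-independent. THEOREMS ONLY; imports `EisensteinHeegnerLog` only.
-/

namespace Summit.BirchSwinnertonDyer.Rank1Residual.X12.O11.RouteU

open DirichletCharacter Literature.NumberTheory.EllipticCurves.KrizLi2019

variable {p : ℕ} [Fact p.Prime] {f d d' : ℕ}

/-- **`ψ₀` of a lifted `ε_K` is the lift of `ψ₀`**: `evenTwist ψ (changeLevel h ε) =
changeLevel _ (evenTwist ψ ε)`. [cite: KrizLi2019, §1.5 (p. 7, display defining ψ₀)] -/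
theorem evenTwist_changeLevel (ψ : DirichletCharacter ℚ_[p] f) (h : d ∣ d')
    (ε : DirichletCharacter ℚ_[p] d) :
    evenTwist ψ (changeLevel h ε) = changeLevel (mul_dvd_mul_left f h) (evenTwist ψ ε) := by
  unfold evenTwist
  split_ifs with hev
  · rw [← changeLevel_trans]
  · rw [map_mul, ← changeLevel_trans, ← changeLevel_trans, ← changeLevel_trans]

/-- **`ψ₀⁻¹ε_K` of a lifted `ε_K` is the lift**: `bernoulliCharOne ψ (changeLevel h ε) =
changeLevel _ (bernoulliCharOne ψ ε)`. [cite: KrizLi2019, Thm. 1.20 (p. 8, the Bernoulli hypothesis)] -/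
theorem bernoulliCharOne_changeLevel (ψ : DirichletCharacter ℚ_[p] f) (h : d ∣ d')
    (ε : DirichletCharacter ℚ_[p] d) :
    bernoulliCharOne ψ (changeLevel h ε) =
      changeLevel (mul_dvd_mul_left f h) (bernoulliCharOne ψ ε) := by
  unfold bernoulliCharOne
  rw [evenTwist_changeLevel, map_mul, map_inv, ← changeLevel_trans, ← changeLevel_trans]

/-- **`ψ₀ω⁻¹` of a lifted `ε_K` is the lift**: `bernoulliCharTwo ψ (changeLevel h ε) ω =
changeLevel _ (bernoulliCharTwo ψ ε ω)`. [cite: KrizLi2019, Thm. 1.20 (p. 8, the Bernoulli hypothesis)] -/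
theorem bernoulliCharTwo_changeLevel (ψ : DirichletCharacter ℚ_[p] f) (h : d ∣ d')
    (ε : DirichletCharacter ℚ_[p] d) (ω : DirichletCharacter ℚ_[p] p) :
    bernoulliCharTwo ψ (changeLevel h ε) ω =
      changeLevel (mul_dvd_mul_right (mul_dvd_mul_left f h) p) (bernoulliCharTwo ψ ε ω) := by
  unfold bernoulliCharTwo
  rw [evenTwist_changeLevel, map_mul, ← changeLevel_trans, ← changeLevel_trans, ← changeLevel_trans]

/-- **Values of a lift at primes not dividing the level**: for `h : d ∣ d'` and a prime `ℓ ∤ d'`,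
`changeLevel h ε ℓ = ε ℓ`. [folklore] -/
theorem changeLevel_apply_prime_of_not_dvd (h : d ∣ d') (ε : DirichletCharacter ℚ_[p] d)
    {ℓ : ℕ} (hℓ : ℓ.Prime) (hℓd : ¬ ℓ ∣ d') :
    changeLevel h ε (ℓ : ZMod d') = ε (ℓ : ZMod d) := by
  have hcop : IsCoprime (ℓ : ℤ) (d' : ℕ) := by
    rw [Int.isCoprime_iff_gcd_eq_one, Int.gcd_natCast_natCast]
    exact (Nat.Prime.coprime_iff_not_dvd hℓ).mpr hℓd
  have := changeLevel_eq_cast_of_dvd' ε h hcop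
  push_cast at this
  exact this

/-- **The Kronecker clause passes to the lift.** If `ε` (level `d`) satisfies "`ε(ℓ) = v ℓ` at every
prime `ℓ ∤ D`" and every prime divisor of `d'` divides `D`, then so does `changeLevel h ε`
(level `d'`, `h : d ∣ d'`). Used with `d = |d_K|`, `d' = 19`, `D = d_K` (and conversely).
[cite: KrizLi2019, §2 (p. 12, ε_K)] -/
theorem changeLevel_apply_prime_eq_of_forall (h : d ∣ d') (ε : DirichletCharacter ℚ_[p] d)
    (D : ℤ) (hd'D : ∀ ℓ : ℕ, ℓ.Prime → ℓ ∣ d' → (ℓ : ℤ) ∣ D) (v : ℕ → ℚ_[p])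
    (hval : ∀ ℓ : ℕ, ℓ.Prime → ¬ ((ℓ : ℤ) ∣ D) → ε (ℓ : ZMod d) = v ℓ) :
    ∀ ℓ : ℕ, ℓ.Prime → ¬ ((ℓ : ℤ) ∣ D) → changeLevel h ε (ℓ : ZMod d') = v ℓ := by
  intro ℓ hℓ hℓD
  rw [changeLevel_apply_prime_of_not_dvd h ε hℓ (fun hdvd => hℓD (hd'D ℓ hℓ hdvd)), hval ℓ hℓ hℓD]

end Summit.BirchSwinnertonDyer.Rank1Residual.X12.O11.RouteU
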